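import Literature.MathematicalPhysics.QuantumFieldTheory.Balaban1983to89.B9Thm313WholeRgdFrom3152
import Literature.MathematicalPhysics.QuantumFieldTheory.Balaban1983to89.B9PerturbationMajorantsAtLettersPhys
import Literature.MathematicalPhysics.QuantumFieldTheory.Balaban1983to89.B9RWSums347DefiniteFaces
import Literature.MathematicalPhysics.QuantumFieldTheory.Balaban1983to89.B9RWSumsDefinitePins
import Literature.MathematicalPhysics.QuantumFieldTheory.Balaban1983to89.B9CoReadingCoordsTranspose
import Literature.MathematicalPhysics.QuantumFieldTheory.Balaban1983to89.B9Thm311SymmAtRecordV4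
import Literature.MathematicalPhysics.QuantumFieldTheory.Balaban1983to89.B9Thm311AdjointPairs
import Literature.MathematicalPhysics.QuantumFieldTheory.Balaban1983to89.B9Thm37GlueTorusCov
import Literature.MathematicalPhysics.QuantumFieldTheory.Balaban1983to89.B9CoReadingCoordsH
import Literature.MathematicalPhysics.QuantumFieldTheory.Balaban1983to89.B9BackgroundsKLevelV1R

/-!
# BalabanUVNodes ∕ N06 ([B9], `Dag.B9_main`) — THE DISPLAYED BLOCK-L² LETTER `hLL2`.1.rgdI (RD\*G₁ = RG′D\* of (3.152), from the bond carrier into the site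
# carrier) OF THE STAGE-11 CERTIFICATE DERIVED AT THE PINS from (3.152) + Theorem 3.1 ∕ (3.49) — dag-n06-l g16's `B9Thm313WholeRgdFrom3152.rgdI_of_ids3152`
# packaged exactly like `N06CutL2LettersAtPinsPhysR.vDRDG_vGDRD_of_pinsR` (same letters, same numerics, one conjunct fewer)

Track A of `YM-PLAN.md` (cell `pub-ymgap`, HUMAN RULING D-0062), node **N06** = [Balaban1985BackgroundPropagators] Thms 3.1–3.15; rows 20–21, seat
`pub-ymgap-dag-n06-c` (g21; LOCATED-23's companion).  A HELPER for dag-n06-d's certificate editions after ED.93 «UT».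
WHY.  The certificate displays `hLL2 : … Letters313L2Pk (𝔬12 x) … B13₄ δ12₃ … U ∧ Letters313L2MZ …`, whose field `rgdI` is the block-L² bound
‖1_{Δ(y)}R∇\*_UG₁μ‖₂ ≦ B13₄·L^{j′}η·e^{−δ12₃d(y,y′)}‖μ‖₂ of the 𝔊-word RD\*G₁ ((3.153)).  Print never estimates RD\*G₁ directly: by (3.152) p. 426 (*"RD\*G₁ = RG′D\*"*) it IS
Theorem 3.1's member G′∇\*_U of the SITE propagator followed by R = ϱ(I − P), and dag-n06-l g16 typed exactly this reduction in block L² (`rgdI_of_ids3152`, from the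
schemas `Thm31GpMaj` (the certificate's DERIVED `h31`, `thm31GpMaj_of_t37_pairMR`) and `Proj349Maj` (the DERIVED `h49`), the transposition letters and (3.152) `Ids3152`
(the certificate's `(hids …).2`)) — the sup twin `rgd2` was folded in ED.77 (`hrgd2_of_pinsP_geo9Y`), the L² field never was.  THIS FILE is the member-uniform package
in the argument order of dag-n06-d's own `vDRDG_vGDRD_of_pinsR` (minus `h46`, minus `hrT4`, plus `0 ≤ δ₃`): ★★ `rgdI_of_pinsR` — ∃ `Mc ≥ M₁`, `B₄ ≥ B₄₀` such that above `Mc`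
and in the regime `(M₁, a₁)`, for every member and every regular `U` satisfying (3.152): the `rgdI` field at `(B₄, δ₃)`.  Inside: the member facts `lemma21Pack_geo9Y` at rate
`rT` with transfer exponent `q.αF`, the row sum `rowSum261_geo9Y` at `σS`, `R = c⁻¹(I − P)` (`rcoK_GpPhysY`, `rcoK_eq`), G′ trace-symmetric (`GpY_isSymmTr ∘ symm0_parSymY`),
`Dᵀ = D\*` (`isTransposePair_DvcoKH_DvscoKH`), `Pᵀ = P` (from `isTransposePair_RcoK`) — all read off «`U` is SU(N)-valued» (`mem_of_reg335R hGR`).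
The knit (dag-n06-d's pen): `hLL2`'s `rgdI` field := `(hrgdI x …).mono …` with `B13₄ := max B13₄ B₄` (the `B₄₀` slot does it in one go, as for `hcut`).
HONEST FRAMING.  By-name composition of kernel-checked helper files; `h31 h49 h152` stay HYPOTHESES (derived resp. displayed in the certificate); nothing of [B9]'s
propagator estimates asserted; COUNT-NEUTRAL; N06 NOT discharged; K1 NOT closed; one finite 𝕋⁴ programme at fixed `ε` — NOT continuum, NOT OS, NOT the mass gap ∕ Clay.
0 `def`, 0 `sorry`.
-/

noncomputable section

namespace Summit.QuantumFields.YangMills.BalabanUVNodes.N06RgdILegAtPinsPhysR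

open Literature.MathematicalPhysics.QuantumFieldTheory.Balaban1983to89
open Literature.MathematicalPhysics.QuantumFieldTheory.Balaban1983to89.Node00 (FBondY IBondY CfgY GpY GpPhysY parSymY)
open Literature.MathematicalPhysics.QuantumFieldTheory.Balaban1983to89.Node00.OpsYSectDCoords (DvcoKH DvscoKH RcoK isTransposePair_DvcoKH_DvscoKH isTransposePair_RcoK cR39_trBasis_pos)
open Literature.MathematicalPhysics.QuantumFieldTheory.Balaban1983to89.B9Thm34Ext (toB6)
open Literature.MathematicalPhysics.QuantumFieldTheory.Balaban1983to89.B11SectG (BlockNorm HasMaj RowSum)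
open Literature.MathematicalPhysics.QuantumFieldTheory.Balaban1983to89.B9SectDL2Decay (BlockBd)
open Literature.MathematicalPhysics.QuantumFieldTheory.Balaban1983to89.B9Thm37Glue (IsTransposePair isTransposePair_one)
open Literature.MathematicalPhysics.QuantumFieldTheory.Balaban1983to89.B9Thm37GlueTorusCov (isTransposePair_smul)
open Literature.MathematicalPhysics.QuantumFieldTheory.Balaban1983to89.B9Thm312Whole (GeoOK)
open Literature.MathematicalPhysics.QuantumFieldTheory.Balaban1983to89.B9RWSums343to347Whole (Facts347)
open Literature.MathematicalPhysics.QuantumFieldTheory.Balaban1983to89.B9RWSumsDefinitePins (PinPrims)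
open Literature.MathematicalPhysics.QuantumFieldTheory.Balaban1983to89.B9RWSums347DefiniteFaces (exp261 lemma21Pack_geo9Y)
open Literature.MathematicalPhysics.QuantumFieldTheory.Balaban1983to89.B9PinMembersKLevelV1 (MemberY geo9Y bg9Y)
open Literature.MathematicalPhysics.QuantumFieldTheory.Balaban1983to89.B9BackgroundsKLevelV1R (RegFamY bg9YR MemOfFam mem_of_reg335R)
open Literature.MathematicalPhysics.QuantumFieldTheory.Balaban1983to89.B9GeoLemma21KLevelV1 (geo9Y_len_pos geo9Y_dist_triangle geo9Y_dist_comm rowSum261_geo9Y)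
open Literature.MathematicalPhysics.QuantumFieldTheory.Balaban1983to89.B9GeoNormsKLevelV1 (geo9K_dist_nonneg)
open Literature.MathematicalPhysics.QuantumFieldTheory.Balaban1983to89.B7Prop2SpecialUnitary (specialUnitaryUnits specialUnitaryUnits_le_unitaryUnits)
open Literature.MathematicalPhysics.QuantumFieldTheory.Balaban1983to89.B9CoReadingCoords (XBK blkBK)
open Literature.MathematicalPhysics.QuantumFieldTheory.Balaban1983to89.B9CoReadingCoordsH (XHK)
open Literature.MathematicalPhysics.QuantumFieldTheory.Balaban1983to89.B9CoReadingCoordsS (XSK GcoS blkSK sIK)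
open Literature.MathematicalPhysics.QuantumFieldTheory.Balaban1983to89.B9CoReadingCoordsTranspose (TrIdx trBasis isTransposePair_GcoS_trBasis)
open Literature.MathematicalPhysics.QuantumFieldTheory.Balaban1983to89.B9Thm39ReadingCoords (cR39 cR39_nonneg)
open Literature.MathematicalPhysics.QuantumFieldTheory.Balaban1983to89.B9PerturbationMajorantAlgebra (Thm31GpMaj Proj349Maj)
open Literature.MathematicalPhysics.QuantumFieldTheory.Balaban1983to89.B9PerturbationMajorantsAtLetters (PcoK rcoK_eq)
open Literature.MathematicalPhysics.QuantumFieldTheory.Balaban1983to89.B9PerturbationMajorantsAtLettersPhys (rcoK_GpPhysY)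
open Literature.MathematicalPhysics.QuantumFieldTheory.Balaban1983to89.B9Thm311AdjointPairs (GpY_isSymmTr)
open Literature.MathematicalPhysics.QuantumFieldTheory.Balaban1983to89.B9Thm311SymmAtRecordV4 (symm0_parSymY)
open Literature.MathematicalPhysics.QuantumFieldTheory.Balaban1983to89.B9Thm313WholeRgdFrom3152 (Ids3152 rgdI_of_ids3152)
open Literature.MathematicalPhysics.QuantumFieldTheory.Balaban1983to89.B6GlobalChartV1 (blkV1)
open Literature.MathematicalPhysics.QuantumFieldTheory.Balaban1983to89.B6Ineq2142KLevelV1 (β lvl)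
open Literature.MathematicalPhysics.QuantumFieldTheory.Balaban1983to89.B6Geom246MultiLevelTorus (geomT)
open scoped Matrix.Norms.L2Operator

variable {N : ℕ} [NeZero N]
variable {d ℓ : ℕ} {hd : 1 ≤ d + 1} {hL : Odd (ℓ + 1) ∧ 1 < ℓ + 1} {b₀ b₁ : ℝ} {Mstar : ℕ}
variable [∀ x : MemberY d ℓ hd hL b₀ b₁ Mstar, Fintype (geo9Y x).Site]

/-- ★★ **`hLL2`.1.rgdI AT THE PINS, MEMBER-UNIFORMLY** (module docstring): from Theorem 3.1 for G′ at the lattice letter (`h31`, shape `Thm31GpMaj`), (3.49) for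
P = I − R (`h49`, shape `Proj349Maj`), the pins `hblk12 hblkW12 hDvco12 hDvsco12 hRco12`, the class axiom `hGR`, the DISPLAYED identity (3.152) (`h152`, shape `Ids3152` at the
G′ model `GcoS … (GpY …)`) and the numerics of `vDRDG_vGDRD_of_pinsR` (`2σS ≤ rT ≤ δ31, δP`, `δ₃ ≤ (1 − 2α_F)rT − σS`, here also `0 ≤ δ₃`): ∃ `Mc ≥ M₁`, `B₄ ≥ B₄₀`, and above
`Mc`, for every member and every regular `U`: ‖1_{Δ(y)}R∇\*_UG₁μ‖₂ ≦ B₄·L^{j′}η·e^{−δ₃d(y,y′)}‖μ‖₂ (`Letters313L2Pk.rgdI`'s statement, the word written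
`R ∘ D\* ∘ G₁ ∘ id` as in the record).  Inside: `lemma21Pack_geo9Y` (rate `rT`, exponent `q.αF`), `rowSum261_geo9Y` at `σS`, dag-n06-l's `rgdI_of_ids3152`.
[cite: Balaban1985BackgroundPropagators, Thm 3.13 p.426, (3.152)–(3.153) p.426, Thm 3.1 (3.42)+(3.46) pp.397–398, (3.49) p.399, (3.25) p.394, p.391, p.398 (remark after (3.47)); Balaban1984PropagatorsII, (2.51)–(2.56) pp.232–233, Lemma 2.1 (2.59)–(2.61) pp.233–234] -/
theorem rgdI_of_pinsR {R₁ R₂ : RegFamY d ℓ hd hL b₀ b₁ Mstar (Matrix (Fin N) (Fin N) ℂ)} (hGR : MemOfFam (specialUnitaryUnits (Fin N)) R₁)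
    (H : MemberY d ℓ hd hL b₀ b₁ Mstar → Prop)
    (bI : ∀ x : MemberY d ℓ hd hL b₀ b₁ Mstar, FBondY x.toKIdx → IBondY x.toKIdx)
    (𝔬12 : ∀ x : MemberY d ℓ hd hL b₀ b₁ Mstar, B9Thm312Whole.Ops (geo9Y x) (bg9YR (Matrix (Fin N) (Fin N) ℂ) (specialUnitaryUnits (Fin N)) R₁ R₂ x)
      (XBK (TrIdx N) x.toKIdx) (XBK (TrIdx N) x.toKIdx) (XHK (TrIdx N) x.toKIdx) (XSK (TrIdx N) x.toKIdx))
    (hblk12 : ∀ x : MemberY d ℓ hd hL b₀ b₁ Mstar, (𝔬12 x).blk = blkBK x.toKIdx (bI x))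
    (hblkW12 : ∀ x : MemberY d ℓ hd hL b₀ b₁ Mstar, (𝔬12 x).blkW = blkSK x.toKIdx (sIK x.toKIdx (bI x)))
    (hDvco12 : ∀ (x : MemberY d ℓ hd hL b₀ b₁ Mstar) (U : (bg9YR (Matrix (Fin N) (Fin N) ℂ) (specialUnitaryUnits (Fin N)) R₁ R₂ x).Cfg),
      (𝔬12 x).Dv U = DvcoKH x.toKIdx (trBasis N) (bg9YR (Matrix (Fin N) (Fin N) ℂ) (specialUnitaryUnits (Fin N)) R₁ R₂ x) (fun U => U) U)
    (hDvsco12 : ∀ (x : MemberY d ℓ hd hL b₀ b₁ Mstar) (U : (bg9YR (Matrix (Fin N) (Fin N) ℂ) (specialUnitaryUnits (Fin N)) R₁ R₂ x).Cfg),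
      (𝔬12 x).Dvstar U = DvscoKH x.toKIdx (trBasis N) (bg9YR (Matrix (Fin N) (Fin N) ℂ) (specialUnitaryUnits (Fin N)) R₁ R₂ x) (fun U => U) U)
    (hRco12 : ∀ (x : MemberY d ℓ hd hL b₀ b₁ Mstar) (U : (bg9YR (Matrix (Fin N) (Fin N) ℂ) (specialUnitaryUnits (Fin N)) R₁ R₂ x).Cfg),
      (𝔬12 x).R U = RcoK x.toKIdx (trBasis N) (bg9YR (Matrix (Fin N) (Fin N) ℂ) (specialUnitaryUnits (Fin N)) R₁ R₂ x) (fun U => U) (parSymY x.toKIdx) (GpPhysY x.toKIdx (parSymY x.toKIdx)) U)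
    (q : PinPrims) (hq : q.OK) {c35 : ℝ} {M₁ a₁ B31 δ31 CP δP rT σS δ₃ : ℝ} (B₄₀ : ℝ)
    (hB31 : 0 ≤ B31) (hCP : 0 ≤ CP) (hσS : 0 < σS) (hrTσ : 2 * σS ≤ rT) (hrT31 : rT ≤ δ31) (hrTP : rT ≤ δP)
    (hδ₃0 : 0 ≤ δ₃) (hδ₃ : δ₃ ≤ (1 - 2 * q.αF) * rT - σS)
    -- Theorem 3.1 for G′ at the LATTICE letter (the certificate's `h31`, from `thm31GpMaj_of_t37_pairMR`)
    (h31 : ∀ x : MemberY d ℓ hd hL b₀ b₁ Mstar, M₁ ≤ (geo9Y x).M → ∀ α₀ : ℝ, 0 < α₀ → (geo9Y x).M * α₀ ≤ a₁ →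
      ∀ U : (bg9YR (Matrix (Fin N) (Fin N) ℂ) (specialUnitaryUnits (Fin N)) R₁ R₂ x).Cfg, (bg9YR (Matrix (Fin N) (Fin N) ℂ) (specialUnitaryUnits (Fin N)) R₁ R₂ x).Reg335 c35 α₀ U →
        Thm31GpMaj (g := geo9Y x) (blkSK x.toKIdx (sIK x.toKIdx (bI x))) (blkBK x.toKIdx (bI x))
          (GcoS x.toKIdx (trBasis N) (bg9YR (Matrix (Fin N) (Fin N) ℂ) (specialUnitaryUnits (Fin N)) R₁ R₂ x) (fun U => U) (GpY x.toKIdx (parSymY x.toKIdx)) U)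
          (DvcoKH x.toKIdx (trBasis N) (bg9YR (Matrix (Fin N) (Fin N) ℂ) (specialUnitaryUnits (Fin N)) R₁ R₂ x) (fun U => U) U)
          (DvscoKH x.toKIdx (trBasis N) (bg9YR (Matrix (Fin N) (Fin N) ℂ) (specialUnitaryUnits (Fin N)) R₁ R₂ x) (fun U => U) U) 1 (H x) B31 δ31)
    -- (3.49) for P = I − R at the lattice letter (the certificate's `h49`, from `proj349Maj_of_t37_display348_rate`)
    (h49 : ∀ x : MemberY d ℓ hd hL b₀ b₁ Mstar, M₁ ≤ (geo9Y x).M → ∀ α₀ : ℝ, 0 < α₀ → (geo9Y x).M * α₀ ≤ a₁ →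
      ∀ U : (bg9YR (Matrix (Fin N) (Fin N) ℂ) (specialUnitaryUnits (Fin N)) R₁ R₂ x).Cfg, (bg9YR (Matrix (Fin N) (Fin N) ℂ) (specialUnitaryUnits (Fin N)) R₁ R₂ x).Reg335 c35 α₀ U →
        Proj349Maj (g := geo9Y x) (blkSK x.toKIdx (sIK x.toKIdx (bI x))) (blkBK x.toKIdx (bI x))
          (PcoK x.toKIdx (trBasis N) (bg9YR (Matrix (Fin N) (Fin N) ℂ) (specialUnitaryUnits (Fin N)) R₁ R₂ x) (fun U => U) (parSymY x.toKIdx) (GpY x.toKIdx (parSymY x.toKIdx)) U)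
          (DvcoKH x.toKIdx (trBasis N) (bg9YR (Matrix (Fin N) (Fin N) ℂ) (specialUnitaryUnits (Fin N)) R₁ R₂ x) (fun U => U) U)
          (DvscoKH x.toKIdx (trBasis N) (bg9YR (Matrix (Fin N) (Fin N) ℂ) (specialUnitaryUnits (Fin N)) R₁ R₂ x) (fun U => U) U) 1 (H x) CP δP)
    -- the DISPLAYED identity (3.152) at the G′ model `GcoS … (GpY …)`
    (h152 : ∀ x : MemberY d ℓ hd hL b₀ b₁ Mstar, M₁ ≤ (geo9Y x).M → ∀ α₀ : ℝ, 0 < α₀ → (geo9Y x).M * α₀ ≤ a₁ →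
      ∀ U : (bg9YR (Matrix (Fin N) (Fin N) ℂ) (specialUnitaryUnits (Fin N)) R₁ R₂ x).Cfg, (bg9YR (Matrix (Fin N) (Fin N) ℂ) (specialUnitaryUnits (Fin N)) R₁ R₂ x).Reg335 c35 α₀ U →
        (bg9YR (Matrix (Fin N) (Fin N) ℂ) (specialUnitaryUnits (Fin N)) R₁ R₂ x).Reg336 c35 α₀ U →
          Ids3152 (𝔬12 x) (fun U => GcoS x.toKIdx (trBasis N) (bg9YR (Matrix (Fin N) (Fin N) ℂ) (specialUnitaryUnits (Fin N)) R₁ R₂ x) (fun U => U) (GpY x.toKIdx (parSymY x.toKIdx)) U) U) :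
    ∃ (Mc B₄ : ℝ), M₁ ≤ Mc ∧ B₄₀ ≤ B₄ ∧
      ∀ x : MemberY d ℓ hd hL b₀ b₁ Mstar, Mc ≤ (geo9Y x).M → ∀ α₀ : ℝ, 0 < α₀ → (geo9Y x).M * α₀ ≤ a₁ →
        ∀ U : (bg9YR (Matrix (Fin N) (Fin N) ℂ) (specialUnitaryUnits (Fin N)) R₁ R₂ x).Cfg, (bg9YR (Matrix (Fin N) (Fin N) ℂ) (specialUnitaryUnits (Fin N)) R₁ R₂ x).Reg335 c35 α₀ U →
          (bg9YR (Matrix (Fin N) (Fin N) ℂ) (specialUnitaryUnits (Fin N)) R₁ R₂ x).Reg336 c35 α₀ U →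
            BlockBd (g := toB6 (geo9Y x) 1 (H x)) (𝔬12 x).blk (𝔬12 x).blkW ((𝔬12 x).R U ∘ₗ (𝔬12 x).Dvstar U ∘ₗ (𝔬12 x).G1 U ∘ₗ LinearMap.id)
              (fun (y y' : (geo9Y x).Site) => B₄ * (geo9Y x).len y' * Real.exp (-(δ₃ * (geo9Y x).dist y y'))) := by
  have hN0 : 0 < N := Nat.pos_of_ne_zero (NeZero.ne N)
  have hc0 : 0 < cR39 (trBasis N) := cR39_trBasis_pos hN0
  have hϱ : 0 ≤ (cR39 (trBasis N))⁻¹ := inv_nonneg.mpr hc0.le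
  have hrT0 : 0 < rT := by linarith only [hσS, hrTσ]
  have h2α : 0 < 1 - 2 * q.α := by linarith only [hq.α_lt]
  -- the member facts at the rate rT (exponent α := q.α inside `exp261`, transfer exponent α_F) and [4] (2.61) at the rate σS, above ONE threshold each
  obtain ⟨Mth, -, hfacts, -⟩ := lemma21Pack_geo9Y (d := d) (ℓ := ℓ) (hd := hd) (hL := hL) (b₀ := b₀) (b₁ := b₁) (Mstar := Mstar) H hq.α_pos hq.α_lt
    (div_pos hrT0 h2α) hq.αF_pos (by linarith only [hq.αF_lt])
  have hrate : (1 - 2 * q.α) * (rT / (1 - 2 * q.α)) = rT := mul_div_cancel₀ rT h2α.ne'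
  obtain ⟨ML, c₁, hrow⟩ := rowSum261_geo9Y (d := d) (ℓ := ℓ) (hd := hd) (hL := hL) (b₀ := b₀) (b₁ := b₁) (Mstar := Mstar) σS hσS
  set c : ℝ := max c₁ 0 with hcdef
  have hc : 0 ≤ c := le_max_right _ _
  set L₀ : ℝ := ((ℓ + 1 : ℕ) : ℝ) with hL₀
  set B₄ : ℝ := max B₄₀ ((cR39 (trBasis N))⁻¹ * (B31 * L₀ * (1 + CP * c))) with hB₄def
  have hB₄b : (cR39 (trBasis N))⁻¹ * (B31 * L₀ * (1 + CP * c)) ≤ B₄ := le_max_right _ _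
  -- the rate bookkeeping of `rgdI_of_ids3152` at (δ := rT, α := q.αF, σ := σS)
  have hαδ : 0 ≤ q.αF * rT := mul_nonneg hq.αF_pos.le hrT0.le
  have hδ₄a : δ₃ ≤ (1 - q.αF) * rT := by nlinarith only [hδ₃, hαδ, hσS.le]
  have hδ₄P : δ₃ + σS ≤ δP := by nlinarith only [hδ₃, hαδ, hrTP]
  refine ⟨max M₁ (max Mth ML), B₄, le_max_left _ _, le_max_left _ _, fun x hM α₀ hα ha U hU hU' => ?_⟩
  have hM1x : M₁ ≤ (geo9Y x).M := (le_max_left _ _).trans hM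
  have hMthx : Mth ≤ (geo9Y x).M := ((le_max_left _ _).trans (le_max_right _ _)).trans hM
  have hMLx : ML ≤ (geo9Y x).M := ((le_max_right _ _).trans (le_max_right _ _)).trans hM
  have hG : GeoOK (geo9Y x) := ⟨geo9Y_dist_triangle x, geo9Y_dist_comm x, geo9K_dist_nonneg x.toKIdx, geo9Y_len_pos x⟩
  have hF := hfacts x hMthx
  rw [hrate] at hF
  have hrowx : RowSum (toB6 (geo9Y x) 1 (H x)) σS c := fun y => (hrow x hMLx y).trans (le_max_left _ _)
  have hUu : ∀ μ z, ((U μ z : (Matrix (Fin N) (Fin N) ℂ)ˣ) : Matrix (Fin N) (Fin N) ℂ) ∈ unitary (Matrix (Fin N) (Fin N) ℂ) :=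
    fun μ z => specialUnitaryUnits_le_unitaryUnits ((mem_of_reg335R hGR x hU) μ z)
  -- Theorem 3.1 read for (𝔬12 x)'s block maps and divergence letters
  have h31p : Thm31GpMaj (g := geo9Y x) (𝔬12 x).blkW (𝔬12 x).blk (GcoS x.toKIdx (trBasis N) (bg9YR (Matrix (Fin N) (Fin N) ℂ) (specialUnitaryUnits (Fin N)) R₁ R₂ x) (fun U => U) (GpY x.toKIdx (parSymY x.toKIdx)) U) ((𝔬12 x).Dv U) ((𝔬12 x).Dvstar U) 1 (H x) B31 δ31 := by
    rw [hblkW12 x, hblk12 x, hDvco12 x U, hDvsco12 x U]; exact h31 x hM1x α₀ hα ha U hU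
  -- (3.49) read for (𝔬12 x)'s letters
  have h49p : Proj349Maj (g := geo9Y x) (𝔬12 x).blkW (𝔬12 x).blk
      (PcoK x.toKIdx (trBasis N) (bg9YR (Matrix (Fin N) (Fin N) ℂ) (specialUnitaryUnits (Fin N)) R₁ R₂ x) (fun U => U) (parSymY x.toKIdx) (GpY x.toKIdx (parSymY x.toKIdx)) U)
      ((𝔬12 x).Dv U) ((𝔬12 x).Dvstar U) 1 (H x) CP δP := by
    rw [hblkW12 x, hblk12 x, hDvco12 x U, hDvsco12 x U]; exact h49 x hM1x α₀ hα ha U hU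
  -- R = ϱ(I − P) at the models (R is degree-0 homogeneous in G′: `rcoK_GpPhysY`)
  have hR : (𝔬12 x).R U = (cR39 (trBasis N))⁻¹ • (LinearMap.id -
      PcoK x.toKIdx (trBasis N) (bg9YR (Matrix (Fin N) (Fin N) ℂ) (specialUnitaryUnits (Fin N)) R₁ R₂ x) (fun U => U) (parSymY x.toKIdx) (GpY x.toKIdx (parSymY x.toKIdx)) U) := by
    rw [hRco12 x U, rcoK_GpPhysY, rcoK_eq]
  -- the transposition letters
  have hGpT : IsTransposePair (GcoS x.toKIdx (trBasis N) (bg9YR (Matrix (Fin N) (Fin N) ℂ) (specialUnitaryUnits (Fin N)) R₁ R₂ x) (fun U => U) (GpY x.toKIdx (parSymY x.toKIdx)) U) (GcoS x.toKIdx (trBasis N) (bg9YR (Matrix (Fin N) (Fin N) ℂ) (specialUnitaryUnits (Fin N)) R₁ R₂ x) (fun U => U) (GpY x.toKIdx (parSymY x.toKIdx)) U) :=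
    isTransposePair_GcoS_trBasis x.toKIdx (bg9YR (Matrix (Fin N) (Fin N) ℂ) (specialUnitaryUnits (Fin N)) R₁ R₂ x) (fun U => U)
      (GpY x.toKIdx (parSymY x.toKIdx)) U (GpY_isSymmTr x.toKIdx (parSymY x.toKIdx) U (symm0_parSymY x.toKIdx specialUnitaryUnits_le_unitaryUnits (mem_of_reg335R hGR x hU)))
  have hDvT : IsTransposePair ((𝔬12 x).Dv U) ((𝔬12 x).Dvstar U) := by
    rw [hDvco12 x U, hDvsco12 x U]
    exact isTransposePair_DvcoKH_DvscoKH x.toKIdx (bg9YR (Matrix (Fin N) (Fin N) ℂ) (specialUnitaryUnits (Fin N)) R₁ R₂ x) (fun U => U) U hUu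
  have hRsym := isTransposePair_RcoK x.toKIdx (bg9YR (Matrix (Fin N) (Fin N) ℂ) (specialUnitaryUnits (Fin N)) R₁ R₂ x) (fun U => U) U
    specialUnitaryUnits_le_unitaryUnits (mem_of_reg335R hGR x hU)
  have hPeq : PcoK x.toKIdx (trBasis N) (bg9YR (Matrix (Fin N) (Fin N) ℂ) (specialUnitaryUnits (Fin N)) R₁ R₂ x) (fun U => U) (parSymY x.toKIdx)
      (GpY x.toKIdx (parSymY x.toKIdx)) U = 1 - (cR39 (trBasis N)) •
        RcoK x.toKIdx (trBasis N) (bg9YR (Matrix (Fin N) (Fin N) ℂ) (specialUnitaryUnits (Fin N)) R₁ R₂ x) (fun U => U) (parSymY x.toKIdx) (GpY x.toKIdx (parSymY x.toKIdx)) U := by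
    rw [rcoK_eq, smul_smul, mul_inv_cancel₀ hc0.ne', one_smul, Module.End.one_eq_id, sub_sub_cancel]
  have hPT : IsTransposePair
      (PcoK x.toKIdx (trBasis N) (bg9YR (Matrix (Fin N) (Fin N) ℂ) (specialUnitaryUnits (Fin N)) R₁ R₂ x) (fun U => U) (parSymY x.toKIdx) (GpY x.toKIdx (parSymY x.toKIdx)) U)
      (PcoK x.toKIdx (trBasis N) (bg9YR (Matrix (Fin N) (Fin N) ℂ) (specialUnitaryUnits (Fin N)) R₁ R₂ x) (fun U => U) (parSymY x.toKIdx) (GpY x.toKIdx (parSymY x.toKIdx)) U) := by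
    rw [hPeq]; exact isTransposePair_one.sub (isTransposePair_smul hRsym _)
  have hI := h152 x hM1x α₀ hα ha U hU hU'
  exact rgdI_of_ids3152 (P := fun U => PcoK x.toKIdx (trBasis N) (bg9YR (Matrix (Fin N) (Fin N) ℂ) (specialUnitaryUnits (Fin N)) R₁ R₂ x) (fun U => U) (parSymY x.toKIdx)
      (GpY x.toKIdx (parSymY x.toKIdx)) U) hG hF hrowx h31p h49p hR hI hGpT hDvT hPT hϱ hB31 hCP hrT31 hδ₃0 hδ₄a hδ₄P hB₄b

end Summit.QuantumFields.YangMills.BalabanUVNodes.N06RgdILegAtPinsPhysR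

end
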